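import Mathlib
import HarnessLib
import Summits.MatrixMultiplication.MatrixMultiplication.Theses.OutsiderSandwich
import Summits.MatrixMultiplication.MatrixMultiplication.Theorems.OutsiderSandwichPackingProfile
import Summits.MatrixMultiplication.MatrixMultiplication.Theorems.OutsiderSandwichLaserTangency

/-!
# OutsiderSandwich — LASER TANGENCY, II: the quantitative law and the exact cut `ω = 2 ⟺ LT ∧ BOTTOM`
(decomp-mm lens 4, gen 10; part I is `OutsiderSandwichLaserTangency.lean`)

* `omega_le_of_laserTangencyAt` — THE QUANTITATIVE LAW: for `0 < s ≤ 1`, the `LT(s)` datum (some cap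
  `b < b_L`) together with BOTTOM = `LaserMergeOptimal` forces `ω(ℂ) ≤ 2/s`.  If `u = 2/ω < s`:
  merge `⟨B⟩ ↦ ⟨a,a,a⟩` inside the packing with `C_δ a^{ω+δ} ≤ B` (`exists_mergeFactor`,
  `merge_restrictsTo`); the single product `⟨am,am,am⟩ ≤ cw₂^{⊠N}` beats the laser-merge line
  `ℓ(ω)·N` by `(s − u)(b_L − b)·N/2` bits once `δ, ε ≍ (s−u)(b_L−b)`, contradicting BOTTOM.  With
  part I (`LT(s)` unconditionally for `s < 2/ω`): UNDER BOTTOM THE TANGENCY THRESHOLD `s*(cw₂)` IS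
  EXACTLY `2/ω`, and the law is RIGID along the multiplicity axis — measured on single products
  (`b = 0`, the item `LaserMergeOptimal`) or on capped packings (any `b < b_L`) it is the same law.
* `summit_of_laserTangency` (`s ↑ 1`), `summit_iff_laserTangency` = item `SummitIffLaserTangency`
  (stmt-32270): `ω(ℂ) = 2 ⟺ LT ∧ BOTTOM`, exact and hypothesis-free.  As ONE deciding theorem,
  `closes (h₁ : LaserTangency) (h₂ : LaserMergeOptimal) (h₃ : SummitIffLaserTangency)` is certified
  by `ledger route check --native` (cell file `decomp-mm-lens-4/g10/glue.lean`; the inlined two-binder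
  form is `g10/glue-inlined.lean`, checked in the route context); the cut of record is unchanged.

Why LT is the MINIMAL existence partner of BOTTOM (paper): for a hypothetical exponent `ω' > 2` the
BOTTOM-world is the affine profile `μ ≤ ℓ_{ω'}(β) := 2/3 + (2/ω')(b_L − β)` on `β ∈ [0, b_L]`
(achieved given `ω ≤ ω'` by laser + merging, and all that BOTTOM allows, by the rigidity above).  An
existence property of the achievable packing set, monotone under enlarging that set, closes the route
with BOTTOM only if it fails in every such world, and «fails under every line `ℓ_{ω'}`, `ω' > 2`» is
literally «for every `s < 1` some achievable point has excess ratio `> s`» = LT (the witness point's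
own `β < b_L` is the cap).  So every honest existence-side cut of this route (TOP, LNT, the rate rungs
`CwTwoRate c` for all `c < 3`, …) implies LT, LT ∧ BOTTOM is still exact, and the lens-4 descent
TOP (g4) → LNT (g9) → LT (g10) ends here on the existence side; the residual law is untouched.

Sources: BurgisserClausenShokrollahi1997 (§15.5, p. 425); Schonhage1981; Blaser2013 (Thm. 5.2);
CoppersmithWinograd1990 (§6); Strassen1988.
-/

set_option linter.dupNamespace false

namespace Summit.MatrixMultiplication.MatrixMultiplication.Theorems.OutsiderSandwichLaserTangencyCut

open scoped BigOperators
open Literature.Computability.AlgebraicComplexity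
open Summit.MatrixMultiplication.MatrixMultiplication.Theses.OutsiderSandwich
  (LaserMergeOptimal LaserTangency SummitIffLaserTangency)
open Summit.MatrixMultiplication.MatrixMultiplication.Theorems.OutsiderSandwichPackingProfile
  (merge_restrictsTo exists_mergeFactor)
open Summit.MatrixMultiplication.MatrixMultiplication.Theorems.OutsiderSandwichLaserTangency
  (laserTangency_of_summit laserMergeOptimal_of_summit)

/-! ## The quantitative law: LT(s) ∧ BOTTOM ⟹ ω ≤ 2/s -/

/-- **QUANTITATIVE CLOSING — each rung of LT is an ω-bound under the law**: the `LT(s)` datum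
(`0 < s ≤ 1`, some cap `b < b_L`) together with BOTTOM forces `ω(ℂ) ≤ 2/s`.  If `u = 2/ω < s`,
merging inside an `LT(s)` packing (`⟨B⟩ ↦ ⟨a,a,a⟩`, `C_δ a^{ω+δ} ≤ B`) produces single products
beyond the laser-merge line `ℓ(ω)` by the margin `(s − u)(b_L − b)·N` bits, contradicting BOTTOM.
[this route, g10; BurgisserClausenShokrollahi1997, §15.5 (p. 425); Blaser2013, Thm. 5.2] -/
theorem omega_le_of_laserTangencyAt {s : ℝ} (hs0 : 0 < s) (hs1 : s ≤ 1)
    (hLT : ∃ b : ℝ, b < Real.logb 2 3 - 2 / 3 ∧ ∀ ε : ℝ, 0 < ε → ∀ N₀ : ℕ,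
      ∃ N : ℕ, N₀ ≤ N ∧ ∃ B m : ℕ,
        TensorRestrictsTo (kroneckerPow (cwTensor ℂ 2) N)
            (kroneckerTensor (unitTensor ℂ B) (matMulTensor ℂ m m m)) ∧
          (B : ℝ) ≤ (2 : ℝ) ^ (b * N) ∧
          (2 : ℝ) ^ ((2 / 3 * (1 - s) - ε) * N) * (3 : ℝ) ^ (s * N) ≤ (B : ℝ) ^ s * (m : ℝ) ^ 2)
    (h₂ : LaserMergeOptimal) : omega ℂ ≤ 2 / s := by
  have hω : 2 ≤ omega ℂ := omega_two_le ℂ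
  by_contra hne
  have hω2 : 2 / s < omega ℂ := lt_of_not_ge hne
  obtain ⟨ω, hωdef⟩ : ∃ w : ℝ, w = omega ℂ := ⟨_, rfl⟩
  rw [← hωdef] at hω hω2
  -- constants
  have hlog2 : 0 < Real.log 2 := Real.log_pos one_lt_two
  have hlog2' : Real.log 2 ≤ 1 := by
    rw [Real.log_le_iff_le_exp (by norm_num)]; linarith [Real.add_one_le_exp (1 : ℝ)]
  have hlog3 : 0 < Real.log 3 := Real.log_pos (by norm_num)
  have hlog3' : Real.log 3 ≤ 2 := by
    rw [Real.log_le_iff_le_exp (by norm_num)]; linarith [Real.add_one_le_exp (2 : ℝ)]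
  have hL : Real.logb 2 3 * Real.log 2 = Real.log 3 := by
    rw [Real.logb, div_mul_cancel₀ _ hlog2.ne']
  have hω0 : 0 < ω := by linarith
  -- `u = 2/ω < s`
  obtain ⟨u, hu⟩ : ∃ u : ℝ, u = 2 / ω := ⟨_, rfl⟩
  have hu0 : 0 < u := hu ▸ div_pos two_pos hω0
  have hsu : u < s := by
    rw [hu, div_lt_iff₀ hω0]
    have := (div_lt_iff₀ hs0).1 hω2
    linarith
  have hu1 : u ≤ 1 := by linarith
  -- the tangency datum at `s`: a cap `b < b_L`
  obtain ⟨b, hb, hP⟩ := hLT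
  obtain ⟨Γ, hΓ⟩ : ∃ G : ℝ, G = Real.log 3 - 2 / 3 * Real.log 2 - b * Real.log 2 := ⟨_, rfl⟩
  have hΓ0 : 0 < Γ := by
    have h1 : 0 < (Real.logb 2 3 - 2 / 3 - b) * Real.log 2 := mul_pos (by linarith) hlog2
    have h2 : (Real.logb 2 3 - 2 / 3 - b) * Real.log 2 = Γ := by rw [hΓ, ← hL]; ring
    linarith
  obtain ⟨M, hM⟩ : ∃ M : ℝ, M = (s - u) * Γ := ⟨_, rfl⟩
  have hM0 : 0 < M := by rw [hM]; exact mul_pos (by linarith) hΓ0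
  -- parameters `δ = M/4`, `ε = M/8`
  obtain ⟨δ, hδ⟩ : ∃ δ : ℝ, δ = M / 4 := ⟨_, rfl⟩
  have hδ0 : 0 < δ := by rw [hδ]; positivity
  obtain ⟨ε, hε⟩ : ∃ ε : ℝ, ε = M / 8 := ⟨_, rfl⟩
  have hε0 : 0 < ε := by rw [hε]; positivity
  obtain ⟨C, hC, hmf⟩ := exists_mergeFactor (δ := δ) hδ0
  rw [← hωdef] at hmf
  obtain ⟨v, hv⟩ : ∃ v : ℝ, v = 2 / (ω + δ) := ⟨_, rfl⟩
  have hωδ : 0 < ω + δ := by linarith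
  have hv0 : 0 < v := hv ▸ div_pos two_pos hωδ
  have hvu : v ≤ u := by
    rw [hu, hv]; exact div_le_div_of_nonneg_left (by norm_num) hω0 (by linarith)
  have hv1 : v ≤ 1 := by linarith
  have huv : u - v ≤ δ / 2 := by
    have e1 : u - v = 2 * δ / (ω * (ω + δ)) := by rw [hu, hv]; field_simp; ring
    have h4 : 4 ≤ ω * (ω + δ) := by nlinarith
    rw [e1, div_le_iff₀ (by positivity)]
    nlinarith
  -- BOTTOM threshold and the witness level
  obtain ⟨N₁, hN₁⟩ := h₂ ε hε0
  rw [← hωdef] at hN₁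
  obtain ⟨K, hK⟩ : ∃ K : ℝ, K = |Real.log C| + 2 * Real.log 2 := ⟨_, rfl⟩
  obtain ⟨N, hN, B, m, hres, hcap, hA⟩ := hP ε hε0 (max N₁ (⌈K / (M / 2)⌉₊ + 1))
  have hNN₁ : N₁ ≤ N := (le_max_left _ _).trans hN
  have hNK : K < M / 2 * N := by
    have h1 : ⌈K / (M / 2)⌉₊ + 1 ≤ N := (le_max_right _ _).trans hN
    have h2 : K / (M / 2) < N := by
      calc K / (M / 2) ≤ ⌈K / (M / 2)⌉₊ := Nat.le_ceil _
        _ < N := by exact_mod_cast (by omega : ⌈K / (M / 2)⌉₊ < N)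
    rw [div_lt_iff₀ (by positivity)] at h2
    linarith
  have hn0 : (0 : ℝ) ≤ N := Nat.cast_nonneg N
  -- `B ≥ 1`, `m ≥ 1`
  have lhs_pos : (0 : ℝ) < (2 : ℝ) ^ ((2 / 3 * (1 - s) - ε) * N) * (3 : ℝ) ^ (s * N) :=
    mul_pos (Real.rpow_pos_of_pos two_pos _) (Real.rpow_pos_of_pos (by norm_num) _)
  have hB1 : 1 ≤ B := by
    by_contra hB
    have hB' : B = 0 := by omega
    rw [hB', Nat.cast_zero, Real.zero_rpow hs0.ne', zero_mul] at hA
    linarith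
  have hB0 : (0 : ℝ) < B := by exact_mod_cast hB1
  have hm0 : (0 : ℝ) < m := by
    rcases Nat.eq_zero_or_pos m with h0 | h0
    · rw [h0, Nat.cast_zero] at hA
      have : (B : ℝ) ^ s * (0 : ℝ) ^ 2 = 0 := by simp
      linarith
    · exact_mod_cast h0
  -- merge
  obtain ⟨a, ha1, haR, hloga⟩ := hmf B hB1
  rw [← hv] at hloga
  have ha0 : (0 : ℝ) < a := by exact_mod_cast ha1
  have hup := hN₁ N hNN₁ (a * m) (merge_restrictsTo hres haR)
  -- logarithms
  have hAL : (2 / 3 * (1 - s) - ε) * N * Real.log 2 + s * N * Real.log 3 ≤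
      s * Real.log B + 2 * Real.log m := by
    have rhs_pos : (0 : ℝ) < (B : ℝ) ^ s * (m : ℝ) ^ 2 :=
      mul_pos (Real.rpow_pos_of_pos hB0 s) (pow_pos hm0 2)
    have := Real.log_le_log lhs_pos hA
    rw [Real.log_mul (Real.rpow_pos_of_pos two_pos _).ne' (Real.rpow_pos_of_pos (by norm_num) _).ne',
      Real.log_rpow two_pos, Real.log_rpow (by norm_num : (0 : ℝ) < 3),
      Real.log_mul (Real.rpow_pos_of_pos hB0 s).ne' (pow_pos hm0 2).ne', Real.log_rpow hB0,
      Real.log_pow] at this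
    push_cast at this
    linarith
  have hcapL : Real.log B ≤ b * N * Real.log 2 := by
    have := Real.log_le_log hB0 hcap
    rwa [Real.log_rpow two_pos] at this
  have hL3 : 2 * Real.log a + 2 * Real.log m ≤
      2 / 3 * N * Real.log 2 + u * N * Real.log 3 - 2 / 3 * u * N * Real.log 2 +
        ε * N * Real.log 2 := by
    have ham : (0 : ℝ) < ((a * m : ℕ) : ℝ) := by push_cast; exact mul_pos ha0 hm0
    have h := Real.log_le_log (pow_pos ham 2) hup
    have lhs : Real.log (((a * m : ℕ) : ℝ) ^ 2) = 2 * Real.log a + 2 * Real.log m := by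
      rw [Real.log_pow]; push_cast; rw [Real.log_mul ha0.ne' hm0.ne']; ring
    have hlog2ne : Real.log 2 ≠ 0 := hlog2.ne'
    have rhs : Real.log ((2 : ℝ) ^ ((2 / 3 + 2 / ω * (Real.logb 2 3 - 2 / 3) + ε) * (N : ℝ))) =
        2 / 3 * N * Real.log 2 + u * N * Real.log 3 - 2 / 3 * u * N * Real.log 2 +
          ε * N * Real.log 2 := by
      rw [Real.log_rpow two_pos, ← hu, Real.logb]; field_simp; ring
    rw [lhs, rhs] at h
    exact h
  -- auxiliary products
  have hsv0 : 0 ≤ s - v := by linarith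
  have huv0 : 0 ≤ u - v := by linarith
  have hF1 : (s - v) * Real.log B ≤ (s - v) * (b * N * Real.log 2) :=
    mul_le_mul_of_nonneg_left hcapL hsv0
  have hbl : b * Real.log 2 ≤ 2 := by
    have h1 : b * Real.log 2 < (Real.logb 2 3 - 2 / 3) * Real.log 2 := mul_lt_mul_of_pos_right hb hlog2
    have h2 : (Real.logb 2 3 - 2 / 3) * Real.log 2 = Real.log 3 - 2 / 3 * Real.log 2 := by
      rw [← hL]; ring
    linarith
  have hF5 : b * N * Real.log 2 ≤ 2 * N := by
    have := mul_le_mul_of_nonneg_right hbl hn0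
    linarith
  have hF2a : (u - v) * (b * N * Real.log 2) ≤ (u - v) * (2 * N) :=
    mul_le_mul_of_nonneg_left hF5 huv0
  have hF2b : (u - v) * N ≤ δ / 2 * N := mul_le_mul_of_nonneg_right huv hn0
  have hF3 : v * Real.log C ≤ |Real.log C| := by
    have h1 : v * Real.log C ≤ v * |Real.log C| := mul_le_mul_of_nonneg_left (le_abs_self _) hv0.le
    have h2 : v * |Real.log C| ≤ 1 * |Real.log C| :=
      mul_le_mul_of_nonneg_right hv1 (abs_nonneg _)
    linarith
  have hF4 : ε * N * Real.log 2 ≤ ε * N := by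
    have := mul_le_mul_of_nonneg_left hlog2' (mul_nonneg hε0.le hn0)
    linarith
  have hMN : M * N = (s - u) * N * Real.log 3 - 2 / 3 * (s - u) * N * Real.log 2 -
      (s - u) * (b * N * Real.log 2) := by rw [hM, hΓ]; ring
  have hδn : δ * N = M / 4 * N := by rw [hδ]
  have hεn : ε * N = M / 8 * N := by rw [hε]
  -- the contradiction
  linarith [hAL, hloga, hL3, hF1, hF2a, hF2b, hF3, hF4, hMN, hδn, hεn, hNK, hK]

/-- **LT ∧ BOTTOM ⟹ `ω(ℂ) = 2`**: `ω ≤ 2/s` for every `s < 1`. [this route, g10] -/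
theorem summit_of_laserTangency (h₁ : LaserTangency) (h₂ : LaserMergeOptimal) :
    _root_.MatrixMultiplication := by
  have hω : 2 ≤ omega ℂ := omega_two_le ℂ
  rw [_root_.MatrixMultiplication_iff]
  refine le_antisymm (le_of_forall_pos_lt_add fun η hη => ?_) hω
  have hs0 : (0 : ℝ) < 2 / (2 + η / 2) := by positivity
  have hs1 : 2 / (2 + η / 2) < 1 := by rw [div_lt_one (by positivity)]; linarith
  have h := omega_le_of_laserTangencyAt hs0 hs1.le (h₁ _ hs0 hs1) h₂
  have e : (2 : ℝ) / (2 / (2 + η / 2)) = 2 + η / 2 := by field_simp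
  linarith

/-! ## The exact cut -/

/-- **`ω(ℂ) = 2 ⟺ LT ∧ BOTTOM`** — exact, ω-free existence piece + residual law. [this route, g10] -/
theorem summit_iff_laserTangency :
    _root_.MatrixMultiplication ↔ (LaserTangency ∧ LaserMergeOptimal) :=
  ⟨fun hS => ⟨laserTangency_of_summit hS, laserMergeOptimal_of_summit hS⟩,
    fun h => summit_of_laserTangency h.1 h.2⟩

/-! ## The route item, by name (rev 10) -/

/-- **Item `OutsiderSandwich.SummitIffLaserTangency` (stmt-MatrixMultiplication-32270) holds**:
`ω(ℂ) = 2 ⟺ LT ∧ BOTTOM`. [this route, g10] -/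
theorem summitIffLaserTangency_holds : SummitIffLaserTangency := summit_iff_laserTangency

end Summit.MatrixMultiplication.MatrixMultiplication.Theorems.OutsiderSandwichLaserTangencyCut
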